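import Literature.NumberTheory.CubicFields.UniformityMaximalPart
import Literature.NumberTheory.QuadraticFields.LocalFundamental
import HarnessLib

/-!
# BTT 2023 Prop. 4.5 (`#{R : q² ∣ Disc R, 0 < ±Disc R < X} ≪ 6^{ω(q)} X/q²`) from BBP Lemma 3.3

`Proofs` file (theorems only: no definitions, no named facts). Topic `Literature/NumberTheory/CubicFields`;
the end of the chain `UniformityOverringStep` → `UniformityMaximalReductionProofs` (the induction over the
primes of `q`, `sum_classNumber_le_of_maximalPartBound`) and `UniformitySubringStep` → `UniformitySubringSum`
→ `UniformitySubringEuler` → `UniformityMaximalPart` (`maximalPartBound_three_of_fieldsBound`) towards the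
named fact `btt_uniformity_sqDvd` of `UniformityEstimate.lean`.

Bhargava–Taniguchi–Thorne 2023, Prop. 4.5 = Belabas–Bhargava–Pomerance 2010, Lemma 3.4, whose published
proof (Taniguchi–Thorne 2013, proof of Lemma 14) has exactly one class-field-theoretic input, BBP
Lemma 3.3: the maximal cubic orders `𝒪_K` with `0 < ±D < X` not fundamental at any prime of the
squarefree `q` number `O(3^{ω(q)} X/q²)`. Everything else is proved in this tree; this file assembles it:

* `prod_stepFactor_three_le` — with `c = 3` the per-prime factors of the induction are
  `stepFactor 3 p = 6·(1 + u_p)`, `u_p = (p⁻² + (p+1)p⁻⁴)/6 ≤ 19/p²`, so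
  `∏_{p ∣ q} stepFactor 3 p ≤ e¹⁹ · 6^{ω(q)}` (the tree's `btt_uniformity_sqDvd_of_maximalPartBound` wanted
  `c ≤ 2`; `c = 3` is what BBP Lemma 3.3 provides, and it suffices);
* `btt_uniformity_sqDvd_of_maximalPartBound_three` — **`MaximalPartBound 3 C → btt_uniformity_sqDvd`**;
* **`btt_uniformity_sqDvd_of_fieldsBound`** — **BTT Prop. 4.5 from the fields bound**: if for some `M`,
  for all odd squarefree `q`, `s = ±1`, `X ∈ ℕ`, the `GL₂(ℤ)`-orbits of irreducible maximal forms `f`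
  (= cubic fields) with `0 < s·Disc f < X` and `q² ∣ Disc f` number `≤ M·3^{ω(q)}·X/q²` — a special case
  of BBP Lemma 3.3 (for odd `p`, "`D` not fundamental at `p`" is `p² ∣ D`) — then `btt_uniformity_sqDvd`;
* **`btt_uniformity_sqDvd_of_notFundamentalBound`** — the same from the bound in the exact shape of BBP
  Lemma 3.3 (all squarefree `q`, condition "`Disc` not fundamental at any `p ∣ q`", `IsFundAt` of
  `QuadraticFields/LocalFundamental.lean`), so that discharging `btt_uniformity_sqDvd` is one line once
  that lemma is in the tree.

NOT here: BBP Lemma 3.3 itself (class field theory over quadratic orders: Hasse's theorem and the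
`3`-rank of ring class groups, with the Davenport–Heilbronn mean value of `#Cl₃`); once it is in the tree
as `bbp33 : Prop` with `bbp33_holds`, `btt_uniformity_sqDvd_holds` is
`btt_uniformity_sqDvd_of_fieldsBound (… bbp33_holds)`.

## References

* M. Bhargava, T. Taniguchi, F. Thorne, *Improved error estimates for the Davenport–Heilbronn
  theorems*, Math. Ann. 389 (2024) = arXiv:2107.12819, §4.2 Prop. 4.5 [BhargavaTaniguchiThorne2023].
* K. Belabas, M. Bhargava, C. Pomerance, *Error estimates for the Davenport–Heilbronn theorems*,
  Duke Math. J. 153 (2010) 173–210, Lemmas 3.3, 3.4 [BelabasBhargavaPomerance2010].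
* T. Taniguchi, F. Thorne, *Secondary terms in counting functions for cubic fields*, Duke Math. J.
  162 (2013), Lemma 14 [TaniguchiThorne2013].
-/

noncomputable section

namespace Literature.NumberTheory.CubicFields

open BinaryCubic RingOfForm Finset Literature.NumberTheory.QuadraticFields

/-- **`∏_{p ∣ q} stepFactor 3 p ≤ e¹⁹ · 6^{ω(q)}`**: `stepFactor 3 p = 6(1 + u_p)` with
`0 ≤ u_p = (p⁻² + (p+1)p⁻⁴)/6 ≤ 19 p⁻²`, and `∏_p (1 + 19p⁻²) ≤ e¹⁹` (`prod_le_exp_of_le`). [folklore] -/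
theorem prod_stepFactor_three_le (q : ℕ) :
    ∏ p ∈ q.primeFactors, stepFactor 3 p ≤ Real.exp 19 * 6 ^ q.primeFactors.card := by
  have hfac : ∀ p ∈ q.primeFactors, stepFactor 3 p =
      6 * (1 + (((p : ℝ) ^ 2)⁻¹ + ((p : ℝ) + 1) * (((p : ℝ) ^ 2)⁻¹) ^ 2) / 6) := by
    intro p hp
    have hp0 : (0 : ℝ) < p := by exact_mod_cast (Nat.prime_of_mem_primeFactors hp).pos
    unfold stepFactor
    field_simp
    ring
  rw [Finset.prod_congr rfl hfac, Finset.prod_mul_distrib, Finset.prod_const, mul_comm]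
  refine mul_le_mul_of_nonneg_right (prod_le_exp_of_le _ (fun p hp => Nat.prime_of_mem_primeFactors hp) _
    (fun p _ => by positivity) fun p hp => ?_) (by positivity)
  have hp2 : (2 : ℝ) ≤ p := by exact_mod_cast (Nat.prime_of_mem_primeFactors hp).two_le
  obtain ⟨hx0, -, -, -⟩ := inv_sq_bounds p (Nat.prime_of_mem_primeFactors hp).two_le
  set x : ℝ := ((p : ℝ) ^ 2)⁻¹ with hx
  have hpx : ((p : ℝ) + 1) * x ≤ 3 / 4 := by
    rw [hx, ← div_eq_mul_inv, div_le_iff₀ (by positivity)]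
    nlinarith
  nlinarith [mul_le_mul_of_nonneg_right hpx hx0]

/-- **`MaximalPartBound 3 C → btt_uniformity_sqDvd`** (BTT Prop. 4.5 from the maximal part with `c = 3`):
`Σ_{0 < ±D < X, q² ∣ D} h(D) ≤ 2C ∏_{p∣q} stepFactor 3 p · X/q² ≤ 2C e¹⁹ · 6^{ω(q)} X/q²`. [folklore] -/
theorem btt_uniformity_sqDvd_of_maximalPartBound_three {C : ℝ} (h : MaximalPartBound 3 C) :
    btt_uniformity_sqDvd := by
  have hC := h.nonneg
  refine ⟨2 * C * Real.exp 19, fun q hq s hs X =>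
    (sum_classNumber_le_of_maximalPartBound (by norm_num) h hq hs X).trans ?_⟩
  have hX : (0 : ℝ) ≤ (X : ℝ) / (q : ℝ) ^ 2 := by positivity
  calc 2 * C * (∏ p ∈ q.primeFactors, stepFactor 3 p) * X / (q : ℝ) ^ 2
      = 2 * C * (∏ p ∈ q.primeFactors, stepFactor 3 p) * (X / (q : ℝ) ^ 2) := by ring
    _ ≤ 2 * C * (Real.exp 19 * 6 ^ q.primeFactors.card) * (X / (q : ℝ) ^ 2) :=
        mul_le_mul_of_nonneg_right (mul_le_mul_of_nonneg_left (prod_stepFactor_three_le q) (by positivity)) hX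
    _ = 2 * C * Real.exp 19 * 6 ^ q.primeFactors.card * X / (q : ℝ) ^ 2 := by ring

/-- **Bhargava–Taniguchi–Thorne 2023, Prop. 4.5, from Belabas–Bhargava–Pomerance 2010, Lemma 3.3.**
If for some absolute `M`, for every odd squarefree `q`, each sign `s = ±1` and every `X ∈ ℕ`, the
`GL₂(ℤ)`-orbits of irreducible maximal integral binary cubic forms `f` (isomorphism classes of maximal
cubic orders `𝒪_K`) with `0 < s·Disc f < X` and `q² ∣ Disc f` number at most `M · 3^{ω(q)} · X/q²` — the
case "odd `q`, `q² ∣ D`" of BBP Lemma 3.3 — then for every squarefree `q` the cubic rings `R` with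
`q² ∣ Disc R`, `0 < ±Disc R < X` number `≪ 6^{ω(q)} X/q²` (`btt_uniformity_sqDvd`). Proof: the overring
recursion and its Euler product (`UniformitySubring*`), the fibration over the maximal overring
(`UniformityMaximalPart`), the induction over the primes of `q` (`UniformityMaximalReductionProofs`).
[cite: BelabasBhargavaPomerance2010, Lemma 3.4 (proof, published version; = BTT 2023 Prop. 4.5, TT 2013 Lemma 14)] -/
theorem btt_uniformity_sqDvd_of_fieldsBound
    (hM : ∃ M : ℝ, ∀ q : ℕ, Squarefree q → ¬ 2 ∣ q → ∀ s : ℤ, (s = 1 ∨ s = -1) → ∀ X : ℕ,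
      (({O | ∃ f : BinaryCubic ℤ, O = gl2zOrbit f ∧ f.IsIrreducible ∧ IsMaximal f ∧ 0 < s * f.disc ∧
        s * f.disc < X ∧ ((q : ℕ) : ℤ) ^ 2 ∣ f.disc}.ncard : ℕ) : ℝ) ≤ M * 3 ^ q.primeFactors.card * X / (q : ℝ) ^ 2) :
    btt_uniformity_sqDvd := by
  obtain ⟨C, hC⟩ := maximalPartBound_three_of_fieldsBound hM
  exact btt_uniformity_sqDvd_of_maximalPartBound_three hC

/-- **BTT Prop. 4.5 from BBP Lemma 3.3 in its printed shape**: if for some absolute `M`, for every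
squarefree `q`, `s = ±1`, `X ∈ ℕ`, the isomorphism classes of maximal cubic orders (orbits of irreducible
maximal forms `f`) with `0 < s·Disc f < X` whose discriminant is not fundamental at any prime divisor of `q`
(`IsFundAt`: `p` odd: `p² ∤ D`; `p = 2`: `D ≡ 1 (4)` or `D ≡ 8, 12 (16)`) number at most
`M · 3^{ω(q)} · X/q²` (Belabas–Bhargava–Pomerance 2010, Lemma 3.3, class field theory — NOT proved in this
tree), then `btt_uniformity_sqDvd` (restrict to odd `q`, where `q² ∣ D` gives `p² ∣ D`, i.e. not
fundamental, at every `p ∣ q`). [cite: BelabasBhargavaPomerance2010, Lemmas 3.3–3.4] -/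
theorem btt_uniformity_sqDvd_of_notFundamentalBound
    (h : ∃ M : ℝ, ∀ q : ℕ, Squarefree q → ∀ s : ℤ, (s = 1 ∨ s = -1) → ∀ X : ℕ,
      (({O | ∃ f : BinaryCubic ℤ, O = gl2zOrbit f ∧ f.IsIrreducible ∧ IsMaximal f ∧ 0 < s * f.disc ∧
        s * f.disc < X ∧ ∀ p ∈ q.primeFactors, ¬ IsFundAt p f.disc}.ncard : ℕ) : ℝ) ≤
        M * 3 ^ q.primeFactors.card * X / (q : ℝ) ^ 2) :
    btt_uniformity_sqDvd := by
  obtain ⟨M, hM⟩ := h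
  refine btt_uniformity_sqDvd_of_fieldsBound ⟨M, fun q hq hq2 s hs X => le_trans ?_ (hM q hq s hs X)⟩
  have hfin : {O | ∃ f : BinaryCubic ℤ, O = gl2zOrbit f ∧ f.IsIrreducible ∧ IsMaximal f ∧ 0 < s * f.disc ∧
      s * f.disc < X ∧ ∀ p ∈ q.primeFactors, ¬ IsFundAt p f.disc}.Finite := by
    refine (maxOrbits_finite ∅ s (X : ℝ) 1).subset ?_
    rintro O ⟨f, rfl, -, -, h0, hX, -⟩
    exact ⟨f, rfl, ⟨h0, by exact_mod_cast hX⟩, by simp, fun ℓ hℓ => absurd hℓ (Finset.notMem_empty ℓ)⟩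
  refine Nat.cast_le.mpr (Set.ncard_le_ncard ?_ hfin)
  rintro O ⟨f, rfl, hirr, hmax, h0, hX, hqD⟩
  refine ⟨f, rfl, hirr, hmax, h0, hX, fun p hp => ?_⟩
  have hp := Nat.prime_of_mem_primeFactors hp
  have hp2 : p ≠ 2 := fun h2 => hq2 (h2 ▸ Nat.dvd_of_mem_primeFactors ‹_›)
  rw [isFundAt_of_ne_two hp2, not_not]
  exact (pow_dvd_pow_of_dvd (Int.natCast_dvd_natCast.mpr (Nat.dvd_of_mem_primeFactors ‹_›)) 2).trans hqD

end Literature.NumberTheory.CubicFields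

end
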